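import Summits.HubbardSuperconductivity.HubbardSuperconductivity.Theorems.AnisotropyChordTransferFibre3FinXDCheck

/-!
# Route `AnisotropyChord` / H0 rotor rung: FIN per-`L` row-D (KT-2a″) cell facts, `L = 9`, cells 72–77

Kernel facts `xdCellAny0 9 (49/50) la lb aD = true` (in-kernel point tables, zero data; `decide +kernel`) for the combined-cell
grid of `L = 9` (g5 design, 1–2.5 % cells); assembled in `…FinXDNine`.  Prover seat `hubbard-h0-rotor-p3` g7; helper for piece A =
stmt-HubbardSuperconductivity-23918 of rung 19089 (`--supports`, helper class).  WHAT THIS IS NOT: nothing here proves superconductivity in the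
Hubbard model (rotor TARGET as worded stays FALSE, g15 verdict); kernel facts for ONE hypothesis of ONE conditional reduction.  No sorry.
-/

set_option linter.dupNamespace false
set_option autoImplicit false

namespace Summit.HubbardSuperconductivity.HubbardSuperconductivity.Theorems.AnisotropyChord.Transfer.Fibre3

namespace FinXD

/-- cell 72 of `L = 9` (`cert`). [folklore] -/
theorem xd9_72 : xdCellAny0 9 (49/50 : ℚ) 4105948634427353 4208597350288037 (3/50 : ℚ) = true := by decide +kernel

/-- cell 73 of `L = 9` (`cert`). [folklore] -/
theorem xd9_73 : xdCellAny0 9 (49/50 : ℚ) 4208597350288037 4313812284045238 (3/50 : ℚ) = true := by decide +kernel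

/-- cell 74 of `L = 9` (`cert`). [folklore] -/
theorem xd9_74 : xdCellAny0 9 (49/50 : ℚ) 4313812284045238 4421657591146369 (3/50 : ℚ) = true := by decide +kernel

/-- cell 75 of `L = 9` (`cert`). [folklore] -/
theorem xd9_75 : xdCellAny0 9 (49/50 : ℚ) 4421657591146369 4532199030925029 (3/50 : ℚ) = true := by decide +kernel

/-- cell 76 of `L = 9` (`cert`). [folklore] -/
theorem xd9_76 : xdCellAny0 9 (49/50 : ℚ) 4532199030925029 4645504006698155 (3/50 : ℚ) = true := by decide +kernel

/-- cell 77 of `L = 9` (`cert`). [folklore] -/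
theorem xd9_77 : xdCellAny0 9 (49/50 : ℚ) 4645504006698155 4761641606865609 (3/50 : ℚ) = true := by decide +kernel

end FinXD

end Summit.HubbardSuperconductivity.HubbardSuperconductivity.Theorems.AnisotropyChord.Transfer.Fibre3
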